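/-
Copyright (c) 2026. All rights reserved.
Released under Apache 2.0 license as described in the file LICENSE.
-/
import Literature.Geometry.Kaehler.ComplexTorusQuaternionCMPointsModTwo
import HarnessLib

/-!
# The classes mod `2𝔬` of the special vectors `L(t)` of Lang's `(−1,3)` order: `t mod 4` decides the parities of
# the coordinates, the mod-`2` invariant of a CM point takes at most THREE values on `Z(t)` (exactly the three classes
# `i, j, ij` for `t ≡ 1`, `i + j, i + ij, j + ij` for `t ≡ 2 (mod 4)`, ONE class for `t ≡ 0, 3 (mod 4)`), and all three
# are attained on `Z(1)` and on `Z(6)`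
# (Kudla–Rapoport–Yang 2006 §3.4 (3.4.8)–(3.4.14), Prop. 3.4.5; Lang 1982 IX §4–§5 Thm. 5.1)

[tag: complex_torus] [tag: abelian_surface] [tag: quaternion_multiplication] [tag: complex_multiplication]
[tag: shimura_curve] [tag: special_cycles] [tag: quaternion_order]

Lane `lit-hodgefound`, seat p12, row g29-#4 — THEOREMS ONLY (no definition, no named fact, no instance); the sequel of
g29-#3 `…QuaternionCMPointsModTwo` (the invariant: `(A(τ₁), ρ) ≅ (A(τ₂), ρ)`, `τ₁ ∈ D_x`, `τ₂ ∈ D_y` ⟹ `y − x ∈ 2𝔬`).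
Here `𝔬 = ℤ⟨1, i, j, ij⟩ ⊂ (−1, 3)_ℚ` (Lang's order), a special vector is `x = x₁i + x₂j + x₃ij ∈ 𝔬` with
`Q(x) = xx̄ = x₁² − 3x₂² − 3x₃² = t`, `L(t) = {x ∈ 𝔬 ∩ V ∣ Q(x) = t}` (KRY (3.4.8)), and `x ≡ y (mod 2𝔬)` is spelled
`∃ w ∈ 𝔬, y − x = 2w`.

## The print, VERBATIM

* S. Kudla, M. Rapoport, T. Yang, *Modular Forms and Special Cycles on Shimura Curves* (2006) [KudlaRapoportYang2006]
  §3.4 (3.4.8) «`L(t) = {x ∈ O_B ∩ V ∣ Q(x) = t}`», (3.4.11) «`[Γ∖D_t] ≃ Z(t)_ℂ`», (3.4.13) «`Z(t)(ℂ) = Σ_{x ∈ L(t) mod Γ}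
  pr(D_x)`», (3.4.14) «so that the computation of `deg Z(t)_ℚ` is reduced to a counting problem», Prop. 3.4.5 «`Z(t)_ℂ`
  is nonempty if and only if `k_t` embeds in `B`».
* S. Lang, *Introduction to Algebraic and Abelian Functions* (1982) [Lang1982AbelianFunctions] Ch. IX §4 (the example
  `(−1, 3)_ℚ`, `𝔬 = ℤ + ℤi + ℤj + ℤij`, `i² = −1`, `j² = 3`), §5 Thm. 5.1 (isomorphism classes `= [𝔬¹∖D]`).

## What is proved

* §1 (`ℤ`-arithmetic of `t = x₁² − 3x₂² − 3x₃² ≡ x₁² + x₂² + x₃² ≡ #{odd xₖ} (mod 4)`): **`t ≡ 1 (mod 4)` ⟹ exactly one of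
  `x₁, x₂, x₃` is odd; `t ≡ 2 (mod 4)` ⟹ exactly two are odd; `t ≡ 3 (mod 4)` ⟹ all three are odd and then
  `t ≡ 3 (mod 8)`; `t ≡ 0 (mod 4)` ⟹ all three are even** (`parity_of_norm_mod_four_eq_one/_two/_zero`,
  `norm_mod_eight_eq_three_of_mod_four_eq_three`; g29-#1 has `t ≢ 7 (mod 8)`, `t ≢ 2 (mod 3)` and `t ≡ 3 (4) ⟺ all odd`,
  the last REUSED here by name).
* §2 (every `(a, b)`): `x ≡ y (mod 2𝔬)` for integral `x, y` iff all coordinates of `y − x` are even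
  (`exists_ofCoords_sub_eq_two_smul_iff`); symmetry / two-out-of-three (`exists_sub_eq_two_smul_symm`,
  `exists_sub_eq_two_smul_of_sub_sub`).
* §3 (`(−1,3)`): **every `x ∈ L(t)` is congruent mod `2𝔬` to one of `i, j, ij` if `t ≡ 1 (mod 4)`, to one of
  `i + j, i + ij, j + ij` if `t ≡ 2 (mod 4)`, to `i + j + ij` if `t ≡ 3 (mod 4)`, to `0` if `t ≡ 0 (mod 4)`**
  (`modTwo_cover_of_norm_mod_four_eq_one/_two/_three/_zero`); hence **for `t ≡ 0, 3 (mod 4)` any two special vectors of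
  `L(t)` are congruent — the mod-`2` invariant is BLIND on these `Z(t)`** (in particular on all the conductor-two members
  `t ≡ 3 (mod 4)` of g29-#2: `exists_sub_eq_two_smul_of_norm_mod_four_eq_three/_zero`), and **for every `t`, among any
  FOUR special vectors of `L(t)` two are congruent mod `2𝔬` — the invariant separates at most three points of `Z(t)`**
  (`exists_ne_sub_eq_two_smul_of_four`).
* §4 the bound three is ATTAINED: **every `x ∈ L(1)` is congruent to exactly one of `i`, `2i + j`, `2i + ij`** (the special
  vectors of the three elliptic points `i`, `(√3 + i)/2`, `(2 − √3)i` of g29-#3) and **every `x ∈ L(6)` to exactly one of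
  `3i + j`, `3i + ij`, `6i + j + 3ij`** (the three `Z(6)`-points `τ₆`, `i√(2 − √3)`, `τ₆″` with `A ≅ (ℂ/ℤ[√−6])²`)
  (`modTwo_classes_norm_one`, `modTwo_classes_norm_six` with the exclusions `…_pairwise_ne`).

## Honest scope

Pure arithmetic of Lang's order; no claim on the number of `Γ`-orbits inside a class, on `#L(t)/Γ` or `deg Z(t)`. The
invariant is the class in `𝔬/2𝔬` only (no finer congruence is claimed to be `Γ`-invariant). 0 definitions, 0 named
facts, 0 instances — net debt `0`.

## References
* [KudlaRapoportYang2006] S. Kudla, M. Rapoport, T. Yang, *Modular Forms and Special Cycles on Shimura Curves*, Ann. of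
  Math. Stud. 161 (2006), §3.4 (3.4.8)–(3.4.14), Prop. 3.4.5.
* [Lang1982AbelianFunctions] S. Lang, *Introduction to Algebraic and Abelian Functions*, 2nd ed. (1982), Ch. IX §4–§5, Thm. 5.1.
-/

noncomputable section

set_option maxSynthPendingDepth 3

open Complex Module Matrix Quaternion Function
open scoped ComplexConjugate

namespace Literature.Geometry.Kaehler.ComplexTorus.QuaternionType

/-! ## §1 `t mod 4` decides the parities of the coordinates of a special vector of Lang's order -/

section Parity

/-- Squares modulo `4`: `n² = 4m` for even `n`, `n² = 4m + 1` for odd `n`. [folklore] -/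
private theorem sq_mod_four' (n : ℤ) : ∃ m : ℤ, (n % 2 = 0 ∧ n ^ 2 = 4 * m) ∨ (n % 2 = 1 ∧ n ^ 2 = 4 * m + 1) := by
  obtain ⟨k, hk | hk⟩ := Int.even_or_odd' n
  · exact ⟨k * k, Or.inl ⟨by omega, by rw [hk]; ring⟩⟩
  · exact ⟨k * k + k, Or.inr ⟨by omega, by rw [hk]; ring⟩⟩

/-- Squares modulo `8`: `n² ∈ {8m, 8m + 4}` for even `n`, `n² = 8m + 1` for odd `n`. [folklore] -/
private theorem sq_mod_eight' (n : ℤ) :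
    ∃ m : ℤ, (n % 2 = 0 ∧ (n ^ 2 = 8 * m ∨ n ^ 2 = 8 * m + 4)) ∨ (n % 2 = 1 ∧ n ^ 2 = 8 * m + 1) := by
  obtain ⟨k, hk | hk⟩ := Int.even_or_odd' n
  · obtain ⟨j, hj | hj⟩ := Int.even_or_odd' k
    · exact ⟨2 * j * j, Or.inl ⟨by omega, Or.inl (by rw [hk, hj]; ring)⟩⟩
    · exact ⟨2 * j * j + 2 * j, Or.inl ⟨by omega, Or.inr (by rw [hk, hj]; ring)⟩⟩
  · obtain ⟨j, hj⟩ := Int.even_mul_succ_self k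
    refine ⟨j, Or.inr ⟨by omega, ?_⟩⟩
    rw [hk]
    linear_combination 4 * hj

variable {x₁ x₂ x₃ : ℤ}

/-- **`t = x₁² − 3x₂² − 3x₃² ≡ 1 (mod 4)` ⟹ exactly one of `x₁, x₂, x₃` is odd** (`t ≡ x₁² + x₂² + x₃² ≡ #{k ∣ xₖ odd}
(mod 4)`). [cite: KudlaRapoportYang2006, §3.4 (3.4.8) («`L(t) = {x ∈ O_B ∩ V ∣ Q(x) = t}`»)] [cite: Lang1982AbelianFunctions, Ch. IX §4 (`i² = −1`, `j² = 3` in `𝔬 = ℤ⟨1, i, j, ij⟩`)] -/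
theorem parity_of_norm_mod_four_eq_one (h : (x₁ ^ 2 - 3 * x₂ ^ 2 - 3 * x₃ ^ 2) % 4 = 1) :
    (x₁ % 2 = 1 ∧ x₂ % 2 = 0 ∧ x₃ % 2 = 0) ∨ (x₁ % 2 = 0 ∧ x₂ % 2 = 1 ∧ x₃ % 2 = 0) ∨
      (x₁ % 2 = 0 ∧ x₂ % 2 = 0 ∧ x₃ % 2 = 1) := by
  obtain ⟨m₁, h₁⟩ := sq_mod_four' x₁
  obtain ⟨m₂, h₂⟩ := sq_mod_four' x₂
  obtain ⟨m₃, h₃⟩ := sq_mod_four' x₃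
  generalize x₁ ^ 2 = P₁ at *
  generalize x₂ ^ 2 = P₂ at *
  generalize x₃ ^ 2 = P₃ at *
  rcases h₁ with ⟨h₁p, h₁s⟩ | ⟨h₁p, h₁s⟩ <;> rcases h₂ with ⟨h₂p, h₂s⟩ | ⟨h₂p, h₂s⟩ <;>
    rcases h₃ with ⟨h₃p, h₃s⟩ | ⟨h₃p, h₃s⟩ <;> omega

/-- **`t ≡ 2 (mod 4)` ⟹ exactly two of `x₁, x₂, x₃` are odd.** [cite: KudlaRapoportYang2006, §3.4 (3.4.8)] [cite: Lang1982AbelianFunctions, Ch. IX §4] -/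
theorem parity_of_norm_mod_four_eq_two (h : (x₁ ^ 2 - 3 * x₂ ^ 2 - 3 * x₃ ^ 2) % 4 = 2) :
    (x₁ % 2 = 1 ∧ x₂ % 2 = 1 ∧ x₃ % 2 = 0) ∨ (x₁ % 2 = 1 ∧ x₂ % 2 = 0 ∧ x₃ % 2 = 1) ∨
      (x₁ % 2 = 0 ∧ x₂ % 2 = 1 ∧ x₃ % 2 = 1) := by
  obtain ⟨m₁, h₁⟩ := sq_mod_four' x₁
  obtain ⟨m₂, h₂⟩ := sq_mod_four' x₂
  obtain ⟨m₃, h₃⟩ := sq_mod_four' x₃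
  generalize x₁ ^ 2 = P₁ at *
  generalize x₂ ^ 2 = P₂ at *
  generalize x₃ ^ 2 = P₃ at *
  rcases h₁ with ⟨h₁p, h₁s⟩ | ⟨h₁p, h₁s⟩ <;> rcases h₂ with ⟨h₂p, h₂s⟩ | ⟨h₂p, h₂s⟩ <;>
    rcases h₃ with ⟨h₃p, h₃s⟩ | ⟨h₃p, h₃s⟩ <;> omega

/-- **`t ≡ 0 (mod 4)` ⟹ `x₁, x₂, x₃` are all even** (so `x ∈ 2𝔬` and `Q(x/2) = t/4`: no PRIMITIVE special vector, g29-#1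
`specialNorm_mod_four_ne_zero`). [cite: KudlaRapoportYang2006, §3.4 (3.4.8) and Prop. 3.4.5] [cite: Lang1982AbelianFunctions, Ch. IX §4] -/
theorem parity_of_norm_mod_four_eq_zero (h : (x₁ ^ 2 - 3 * x₂ ^ 2 - 3 * x₃ ^ 2) % 4 = 0) :
    x₁ % 2 = 0 ∧ x₂ % 2 = 0 ∧ x₃ % 2 = 0 := by
  obtain ⟨m₁, h₁⟩ := sq_mod_four' x₁
  obtain ⟨m₂, h₂⟩ := sq_mod_four' x₂
  obtain ⟨m₃, h₃⟩ := sq_mod_four' x₃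
  generalize x₁ ^ 2 = P₁ at *
  generalize x₂ ^ 2 = P₂ at *
  generalize x₃ ^ 2 = P₃ at *
  rcases h₁ with ⟨h₁p, h₁s⟩ | ⟨h₁p, h₁s⟩ <;> rcases h₂ with ⟨h₂p, h₂s⟩ | ⟨h₂p, h₂s⟩ <;>
    rcases h₃ with ⟨h₃p, h₃s⟩ | ⟨h₃p, h₃s⟩ <;> omega

/-- `t ≡ 3 (mod 4)` ⟹ `x₁, x₂, x₃` are all odd: g29-#1's `specialNorm_mod_four_eq_three_iff`, for bare integers. [cite: KudlaRapoportYang2006, §3.4 (3.4.8)] -/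
private theorem parity_of_norm_mod_four_eq_three (h : (x₁ ^ 2 - 3 * x₂ ^ 2 - 3 * x₃ ^ 2) % 4 = 3) :
    x₁ % 2 = 1 ∧ x₂ % 2 = 1 ∧ x₃ % 2 = 1 := by
  simpa using (specialNorm_mod_four_eq_three_iff ![x₁, x₂, x₃]).1 (by simpa using h)

/-- **`t ≡ 3 (mod 4)` ⟹ `t ≡ 3 (mod 8)`** (three odd squares: `1 − 3 − 3 ≡ 3 (mod 8)`; with g29-#1's `t ≢ 7 (mod 8)` this is
the whole story modulo `8` for odd `t ≡ 3 (4)`). [cite: KudlaRapoportYang2006, §3.4 Prop. 3.4.5 and (3.4.8)] [cite: Lang1982AbelianFunctions, Ch. IX §4] -/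
theorem norm_mod_eight_eq_three_of_mod_four_eq_three (h : (x₁ ^ 2 - 3 * x₂ ^ 2 - 3 * x₃ ^ 2) % 4 = 3) :
    (x₁ ^ 2 - 3 * x₂ ^ 2 - 3 * x₃ ^ 2) % 8 = 3 := by
  obtain ⟨m₁, h₁⟩ := sq_mod_eight' x₁
  obtain ⟨m₂, h₂⟩ := sq_mod_eight' x₂
  obtain ⟨m₃, h₃⟩ := sq_mod_eight' x₃
  generalize x₁ ^ 2 = P₁ at *
  generalize x₂ ^ 2 = P₂ at *
  generalize x₃ ^ 2 = P₃ at *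
  rcases h₁ with ⟨-, h₁s | h₁s⟩ | ⟨-, h₁s⟩ <;> rcases h₂ with ⟨-, h₂s | h₂s⟩ | ⟨-, h₂s⟩ <;>
    rcases h₃ with ⟨-, h₃s | h₃s⟩ | ⟨-, h₃s⟩ <;> omega

end Parity

/-! ## §2 Congruence mod `2𝔬` of integral quaternions, in coordinates (every `(a, b)`) -/

section Classes

variable {a b : ℤ}

/-- The difference of two integral quaternions in coordinates. [cite: Lang1982AbelianFunctions, Ch. IX §4 («`𝔬 = ℤ + ℤi + ℤj + ℤij`»)] -/
theorem ofCoords_intCast_sub (m n : Fin 4 → ℤ) :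
    ofCoords a b (fun k ↦ ((n k : ℤ) : ℚ)) - ofCoords a b (fun k ↦ ((m k : ℤ) : ℚ)) =
      ofCoords a b (fun k ↦ ((n k - m k : ℤ) : ℚ)) := by
  ext <;> simp [ofCoords]

/-- **`y ≡ x (mod 2𝔬)` iff all coordinates of `y − x` are even** (`x, y ∈ 𝔬 = ℤ⟨1, i, j, ij⟩` given by their coordinates
`m, n`). [cite: Lang1982AbelianFunctions, Ch. IX §4 («`𝔬 = ℤ + ℤi + ℤj + ℤij`»)] -/
theorem exists_ofCoords_sub_eq_two_smul_iff (m n : Fin 4 → ℤ) :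
    (∃ w ∈ order a b, ofCoords a b (fun k ↦ ((n k : ℤ) : ℚ)) - ofCoords a b (fun k ↦ ((m k : ℤ) : ℚ)) = (2 : ℚ) • w) ↔
      ∀ k, 2 ∣ n k - m k := by
  rw [ofCoords_intCast_sub]
  refine ⟨fun ⟨w, hw, h⟩ k ↦ even_of_ofCoords_eq_two_smul hw h k, fun h ↦ ?_⟩
  obtain ⟨c, hc⟩ : ∃ c : Fin 4 → ℤ, ∀ k, n k - m k = 2 * c k :=
    ⟨fun k ↦ (n k - m k) / 2, fun k ↦ by dsimp only; have := h k; omega⟩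
  refine ⟨ofCoords a b (fun k ↦ ((c k : ℤ) : ℚ)), ofCoords_intCast_mem_order a b _, ?_⟩
  have hf : (fun k ↦ ((n k - m k : ℤ) : ℚ)) = fun k ↦ (2 : ℚ) * ((c k : ℤ) : ℚ) :=
    funext fun k ↦ by rw [hc k, Int.cast_mul, Int.cast_ofNat]
  rw [hf]
  ext <;> simp [ofCoords]

/-- Symmetry: `y ≡ x ⟹ x ≡ y (mod 2𝔬)`. [cite: Lang1982AbelianFunctions, Ch. IX §4] -/
theorem exists_sub_eq_two_smul_symm {x y : ℍ[ℚ,(a : ℚ),(b : ℚ)]} (h : ∃ w ∈ order a b, y - x = (2 : ℚ) • w) :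
    ∃ w ∈ order a b, x - y = (2 : ℚ) • w := by
  obtain ⟨w, hw, h⟩ := h
  exact ⟨-w, (order a b).neg_mem hw, by rw [← neg_sub, h, smul_neg]⟩

/-- Two-out-of-three: `x ≡ r` and `y ≡ r` ⟹ `y ≡ x (mod 2𝔬)`. [cite: Lang1982AbelianFunctions, Ch. IX §4] -/
theorem exists_sub_eq_two_smul_of_sub_sub {x y r : ℍ[ℚ,(a : ℚ),(b : ℚ)]} (hx : ∃ w ∈ order a b, x - r = (2 : ℚ) • w)
    (hy : ∃ w ∈ order a b, y - r = (2 : ℚ) • w) : ∃ w ∈ order a b, y - x = (2 : ℚ) • w := by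
  obtain ⟨w₁, hw₁, h₁⟩ := hx
  obtain ⟨w₂, hw₂, h₂⟩ := hy
  exact ⟨w₂ - w₁, (order a b).sub_mem hw₂ hw₁, by rw [← sub_sub_sub_cancel_right y x r, h₂, h₁, smul_sub]⟩

/-- If `r − r′` has an odd coordinate, no `x` is congruent to both `r` and `r′`. [cite: Lang1982AbelianFunctions, Ch. IX §4] -/
theorem not_and_of_odd_coord {x r r' : ℍ[ℚ,(a : ℚ),(b : ℚ)]} {m : Fin 4 → ℤ}
    (hm : r' - r = ofCoords a b (fun k ↦ ((m k : ℤ) : ℚ))) {k : Fin 4} (hk : ¬ 2 ∣ m k) :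
    ¬ ((∃ w ∈ order a b, x - r = (2 : ℚ) • w) ∧ ∃ w ∈ order a b, x - r' = (2 : ℚ) • w) := by
  rintro ⟨hr, hr'⟩
  obtain ⟨w, hw, h⟩ := exists_sub_eq_two_smul_of_sub_sub (exists_sub_eq_two_smul_symm hr)
    (exists_sub_eq_two_smul_symm hr')
  rw [hm] at h
  exact hk (even_of_ofCoords_eq_two_smul hw h k)

end Classes

/-! ## §3 `(−1,3)`: the classes of `L(t)` mod `2𝔬` — at most three, one for `t ≡ 0, 3 (mod 4)` -/

section NegOneThree

/-- The coordinates of a special vector of Lang's order: `x = ofCoords m` pure means `m₀ = 0`, and then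
`Q(x) = m₁² − 3m₂² − 3m₃²`. [cite: Lang1982AbelianFunctions, Ch. IX §4–§5 ((3): `nr`)] [cite: KudlaRapoportYang2006, §3.4 (3.4.8)] -/
theorem coords_of_special {m : Fin 4 → ℤ} (hx : (ofCoords (-1) 3 (fun k ↦ ((m k : ℤ) : ℚ))).re = 0) {t : ℤ}
    (hQ : (ofCoords (-1) 3 (fun k ↦ ((m k : ℤ) : ℚ)) * star (ofCoords (-1) 3 (fun k ↦ ((m k : ℤ) : ℚ)))).re = t) :
    m 0 = 0 ∧ m 1 ^ 2 - 3 * m 2 ^ 2 - 3 * m 3 ^ 2 = t := by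
  have h0 : m 0 = 0 := by simpa [ofCoords] using hx
  rw [re_ofCoords_intCast_mul_star_self] at hQ
  have hQ' : m 0 ^ 2 - (-1) * m 1 ^ 2 - 3 * m 2 ^ 2 + (-1) * 3 * m 3 ^ 2 = t := by exact_mod_cast hQ
  refine ⟨h0, ?_⟩
  rw [h0] at hQ'
  linarith

/-- `i, j, ij, i + j, i + ij, j + ij, i + j + ij` as integral quaternions (coordinates). [cite: Lang1982AbelianFunctions, Ch. IX §4] -/
private theorem reps_eq_ofCoords :
    (⟨0, 1, 0, 0⟩ : ℍ[ℚ,((-1 : ℤ) : ℚ),((3 : ℤ) : ℚ)]) = ofCoords (-1) 3 (fun k ↦ ((![0, 1, 0, 0] k : ℤ) : ℚ)) ∧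
    (⟨0, 0, 1, 0⟩ : ℍ[ℚ,((-1 : ℤ) : ℚ),((3 : ℤ) : ℚ)]) = ofCoords (-1) 3 (fun k ↦ ((![0, 0, 1, 0] k : ℤ) : ℚ)) ∧
    (⟨0, 0, 0, 1⟩ : ℍ[ℚ,((-1 : ℤ) : ℚ),((3 : ℤ) : ℚ)]) = ofCoords (-1) 3 (fun k ↦ ((![0, 0, 0, 1] k : ℤ) : ℚ)) ∧
    (⟨0, 1, 1, 0⟩ : ℍ[ℚ,((-1 : ℤ) : ℚ),((3 : ℤ) : ℚ)]) = ofCoords (-1) 3 (fun k ↦ ((![0, 1, 1, 0] k : ℤ) : ℚ)) ∧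
    (⟨0, 1, 0, 1⟩ : ℍ[ℚ,((-1 : ℤ) : ℚ),((3 : ℤ) : ℚ)]) = ofCoords (-1) 3 (fun k ↦ ((![0, 1, 0, 1] k : ℤ) : ℚ)) ∧
    (⟨0, 0, 1, 1⟩ : ℍ[ℚ,((-1 : ℤ) : ℚ),((3 : ℤ) : ℚ)]) = ofCoords (-1) 3 (fun k ↦ ((![0, 0, 1, 1] k : ℤ) : ℚ)) ∧
    (⟨0, 1, 1, 1⟩ : ℍ[ℚ,((-1 : ℤ) : ℚ),((3 : ℤ) : ℚ)]) = ofCoords (-1) 3 (fun k ↦ ((![0, 1, 1, 1] k : ℤ) : ℚ)) := by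
  refine ⟨?_, ?_, ?_, ?_, ?_, ?_, ?_⟩ <;> ext <;> simp [ofCoords]

/-- **`t ≡ 1 (mod 4)`: every `x ∈ L(t)` is congruent mod `2𝔬` to `i`, to `j` or to `ij`.** [cite: KudlaRapoportYang2006, §3.4 (3.4.8), (3.4.13)] [cite: Lang1982AbelianFunctions, Ch. IX §4–§5 Thm. 5.1] -/
theorem modTwo_cover_of_norm_mod_four_eq_one {x : ℍ[ℚ,((-1 : ℤ) : ℚ),((3 : ℤ) : ℚ)]} (hxo : x ∈ order (-1) 3)
    (hx : x.re = 0) {t : ℤ} (hQ : (x * star x).re = t) (ht : t % 4 = 1) :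
    (∃ w ∈ order (-1) 3, x - ⟨0, 1, 0, 0⟩ = (2 : ℚ) • w) ∨ (∃ w ∈ order (-1) 3, x - ⟨0, 0, 1, 0⟩ = (2 : ℚ) • w) ∨
      (∃ w ∈ order (-1) 3, x - ⟨0, 0, 0, 1⟩ = (2 : ℚ) • w) := by
  obtain ⟨m, rfl⟩ := hxo
  obtain ⟨h0, hmt⟩ := coords_of_special hx hQ
  rw [← hmt] at ht
  obtain ⟨e₁, e₂, e₃, -⟩ := reps_eq_ofCoords
  rw [e₁, e₂, e₃, exists_ofCoords_sub_eq_two_smul_iff, exists_ofCoords_sub_eq_two_smul_iff,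
    exists_ofCoords_sub_eq_two_smul_iff]
  rcases parity_of_norm_mod_four_eq_one ht with ⟨h₁, h₂, h₃⟩ | ⟨h₁, h₂, h₃⟩ | ⟨h₁, h₂, h₃⟩
  · refine Or.inl fun k ↦ ?_
    fin_cases k <;> simp <;> omega
  · refine Or.inr (Or.inl fun k ↦ ?_)
    fin_cases k <;> simp <;> omega
  · refine Or.inr (Or.inr fun k ↦ ?_)
    fin_cases k <;> simp <;> omega

/-- **`t ≡ 2 (mod 4)`: every `x ∈ L(t)` is congruent mod `2𝔬` to `i + j`, to `i + ij` or to `j + ij`.** [cite: KudlaRapoportYang2006, §3.4 (3.4.8), (3.4.13)] [cite: Lang1982AbelianFunctions, Ch. IX §4–§5 Thm. 5.1] -/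
theorem modTwo_cover_of_norm_mod_four_eq_two {x : ℍ[ℚ,((-1 : ℤ) : ℚ),((3 : ℤ) : ℚ)]} (hxo : x ∈ order (-1) 3)
    (hx : x.re = 0) {t : ℤ} (hQ : (x * star x).re = t) (ht : t % 4 = 2) :
    (∃ w ∈ order (-1) 3, x - ⟨0, 1, 1, 0⟩ = (2 : ℚ) • w) ∨ (∃ w ∈ order (-1) 3, x - ⟨0, 1, 0, 1⟩ = (2 : ℚ) • w) ∨
      (∃ w ∈ order (-1) 3, x - ⟨0, 0, 1, 1⟩ = (2 : ℚ) • w) := by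
  obtain ⟨m, rfl⟩ := hxo
  obtain ⟨h0, hmt⟩ := coords_of_special hx hQ
  rw [← hmt] at ht
  obtain ⟨-, -, -, e₁, e₂, e₃, -⟩ := reps_eq_ofCoords
  rw [e₁, e₂, e₃, exists_ofCoords_sub_eq_two_smul_iff, exists_ofCoords_sub_eq_two_smul_iff,
    exists_ofCoords_sub_eq_two_smul_iff]
  rcases parity_of_norm_mod_four_eq_two ht with ⟨h₁, h₂, h₃⟩ | ⟨h₁, h₂, h₃⟩ | ⟨h₁, h₂, h₃⟩
  · refine Or.inl fun k ↦ ?_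
    fin_cases k <;> simp <;> omega
  · refine Or.inr (Or.inl fun k ↦ ?_)
    fin_cases k <;> simp <;> omega
  · refine Or.inr (Or.inr fun k ↦ ?_)
    fin_cases k <;> simp <;> omega

/-- **`t ≡ 3 (mod 4)`: every `x ∈ L(t)` is congruent mod `2𝔬` to `i + j + ij`** (one class). [cite: KudlaRapoportYang2006, §3.4 (3.4.8), (3.4.13)] [cite: Lang1982AbelianFunctions, Ch. IX §4–§5 Thm. 5.1] -/
theorem modTwo_cover_of_norm_mod_four_eq_three {x : ℍ[ℚ,((-1 : ℤ) : ℚ),((3 : ℤ) : ℚ)]} (hxo : x ∈ order (-1) 3)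
    (hx : x.re = 0) {t : ℤ} (hQ : (x * star x).re = t) (ht : t % 4 = 3) :
    ∃ w ∈ order (-1) 3, x - ⟨0, 1, 1, 1⟩ = (2 : ℚ) • w := by
  obtain ⟨m, rfl⟩ := hxo
  obtain ⟨h0, hmt⟩ := coords_of_special hx hQ
  rw [← hmt] at ht
  obtain ⟨h₁, h₂, h₃⟩ := parity_of_norm_mod_four_eq_three ht
  rw [reps_eq_ofCoords.2.2.2.2.2.2, exists_ofCoords_sub_eq_two_smul_iff]
  intro k
  fin_cases k <;> simp <;> omega

/-- **`t ≡ 0 (mod 4)`: every `x ∈ L(t)` lies in `2𝔬`** (one class, that of `0`). [cite: KudlaRapoportYang2006, §3.4 (3.4.8) and Prop. 3.4.5] [cite: Lang1982AbelianFunctions, Ch. IX §4] -/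
theorem modTwo_cover_of_norm_mod_four_eq_zero {x : ℍ[ℚ,((-1 : ℤ) : ℚ),((3 : ℤ) : ℚ)]} (hxo : x ∈ order (-1) 3)
    (hx : x.re = 0) {t : ℤ} (hQ : (x * star x).re = t) (ht : t % 4 = 0) :
    ∃ w ∈ order (-1) 3, x = (2 : ℚ) • w := by
  obtain ⟨m, rfl⟩ := hxo
  obtain ⟨h0, hmt⟩ := coords_of_special hx hQ
  rw [← hmt] at ht
  obtain ⟨h₁, h₂, h₃⟩ := parity_of_norm_mod_four_eq_zero ht
  obtain ⟨w, hw, h⟩ := (exists_ofCoords_sub_eq_two_smul_iff (a := -1) (b := 3) 0 m).2 fun k ↦ by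
    fin_cases k <;> simp <;> omega
  have hz : ofCoords (-1) 3 (fun k ↦ (((0 : Fin 4 → ℤ) k : ℤ) : ℚ)) = 0 := by ext <;> simp [ofCoords]
  rw [hz, sub_zero] at h
  exact ⟨w, hw, h⟩

/-- **BLINDNESS for `t ≡ 3 (mod 4)`: any two special vectors of `L(t)` are congruent mod `2𝔬`** — the parity obstruction
of g29-#3 (`not_isRhoIsomorphic_of_odd_coord`) never applies on these `Z(t)` (all the conductor-two members of g29-#2,
e.g. `t = 3, 19`). [cite: KudlaRapoportYang2006, §3.4 (3.4.13)–(3.4.14)] [cite: Lang1982AbelianFunctions, Ch. IX §5 Thm. 5.1] -/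
theorem exists_sub_eq_two_smul_of_norm_mod_four_eq_three {x y : ℍ[ℚ,((-1 : ℤ) : ℚ),((3 : ℤ) : ℚ)]}
    (hxo : x ∈ order (-1) 3) (hyo : y ∈ order (-1) 3) (hx : x.re = 0) (hy : y.re = 0) {t : ℤ}
    (hQx : (x * star x).re = t) (hQy : (y * star y).re = t) (ht : t % 4 = 3) :
    ∃ w ∈ order (-1) 3, y - x = (2 : ℚ) • w :=
  exists_sub_eq_two_smul_of_sub_sub (modTwo_cover_of_norm_mod_four_eq_three hxo hx hQx ht)
    (modTwo_cover_of_norm_mod_four_eq_three hyo hy hQy ht)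

/-- **BLINDNESS for `t ≡ 0 (mod 4)`** (both vectors lie in `2𝔬`). [cite: KudlaRapoportYang2006, §3.4 (3.4.13)–(3.4.14)] [cite: Lang1982AbelianFunctions, Ch. IX §5 Thm. 5.1] -/
theorem exists_sub_eq_two_smul_of_norm_mod_four_eq_zero {x y : ℍ[ℚ,((-1 : ℤ) : ℚ),((3 : ℤ) : ℚ)]}
    (hxo : x ∈ order (-1) 3) (hyo : y ∈ order (-1) 3) (hx : x.re = 0) (hy : y.re = 0) {t : ℤ}
    (hQx : (x * star x).re = t) (hQy : (y * star y).re = t) (ht : t % 4 = 0) :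
    ∃ w ∈ order (-1) 3, y - x = (2 : ℚ) • w := by
  obtain ⟨w₁, hw₁, h₁⟩ := modTwo_cover_of_norm_mod_four_eq_zero hxo hx hQx ht
  obtain ⟨w₂, hw₂, h₂⟩ := modTwo_cover_of_norm_mod_four_eq_zero hyo hy hQy ht
  exact ⟨w₂ - w₁, (order (-1) 3).sub_mem hw₂ hw₁, by rw [h₁, h₂, smul_sub]⟩

/-- **AT MOST THREE: among any four special vectors of `L(t)` two are congruent mod `2𝔬`** — the mod-`2` invariant of
g29-#3 separates at most three points of `Z(t) = Σ_{x ∈ L(t) mod Γ} pr(D_x)`, for every `t`. [cite: KudlaRapoportYang2006, §3.4 (3.4.13)–(3.4.14) («reduced to a counting problem»)] [cite: Lang1982AbelianFunctions, Ch. IX §5 Thm. 5.1] -/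
theorem exists_ne_sub_eq_two_smul_of_four (x : Fin 4 → ℍ[ℚ,((-1 : ℤ) : ℚ),((3 : ℤ) : ℚ)])
    (hxo : ∀ n, x n ∈ order (-1) 3) (hx : ∀ n, (x n).re = 0) {t : ℤ} (hQ : ∀ n, (x n * star (x n)).re = t) :
    ∃ n n', n ≠ n' ∧ ∃ w ∈ order (-1) 3, x n' - x n = (2 : ℚ) • w := by
  have hcases : t % 4 = 0 ∨ t % 4 = 1 ∨ t % 4 = 2 ∨ t % 4 = 3 := by omega
  -- pigeonhole on three representatives
  have pigeon : ∀ R : Fin 3 → ℍ[ℚ,((-1 : ℤ) : ℚ),((3 : ℤ) : ℚ)],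
      (∀ n, ∃ r, ∃ w ∈ order (-1) 3, x n - R r = (2 : ℚ) • w) →
        ∃ n n', n ≠ n' ∧ ∃ w ∈ order (-1) 3, x n' - x n = (2 : ℚ) • w := by
    intro R hR
    choose f hf using hR
    obtain ⟨n, n', hne, hff⟩ := Fintype.exists_ne_map_eq_of_card_lt f (by simp)
    refine ⟨n, n', hne, exists_sub_eq_two_smul_of_sub_sub (hf n) ?_⟩
    rw [hff]
    exact hf n'
  rcases hcases with ht | ht | ht | ht
  · exact ⟨0, 1, by decide, exists_sub_eq_two_smul_of_norm_mod_four_eq_zero (hxo 0) (hxo 1) (hx 0) (hx 1) (hQ 0)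
      (hQ 1) ht⟩
  · refine pigeon ![⟨0, 1, 0, 0⟩, ⟨0, 0, 1, 0⟩, ⟨0, 0, 0, 1⟩] fun n ↦ ?_
    rcases modTwo_cover_of_norm_mod_four_eq_one (hxo n) (hx n) (hQ n) ht with h | h | h
    · exact ⟨0, by simpa using h⟩
    · exact ⟨1, by simpa using h⟩
    · exact ⟨2, by simpa using h⟩
  · refine pigeon ![⟨0, 1, 1, 0⟩, ⟨0, 1, 0, 1⟩, ⟨0, 0, 1, 1⟩] fun n ↦ ?_
    rcases modTwo_cover_of_norm_mod_four_eq_two (hxo n) (hx n) (hQ n) ht with h | h | h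
    · exact ⟨0, by simpa using h⟩
    · exact ⟨1, by simpa using h⟩
    · exact ⟨2, by simpa using h⟩
  · exact ⟨0, 1, by decide, exists_sub_eq_two_smul_of_norm_mod_four_eq_three (hxo 0) (hxo 1) (hx 0) (hx 1) (hQ 0)
      (hQ 1) ht⟩

end NegOneThree

/-! ## §4 The bound three is attained on `Z(1)` and on `Z(6)` -/

section Attained

/-- **Every `x ∈ L(1)` is congruent mod `2𝔬` to `i`, to `2i + j` or to `2i + ij`** — the special vectors of the three
pairwise inequivalent elliptic points `i`, `(√3 + i)/2`, `(2 − √3)i` of g29-#3 represent ALL classes of `L(1)`.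
[cite: KudlaRapoportYang2006, §3.4 (3.4.8), (3.4.13)–(3.4.14)] [cite: Lang1982AbelianFunctions, Ch. IX §4–§5 Thm. 5.1] -/
theorem modTwo_classes_norm_one {x : ℍ[ℚ,((-1 : ℤ) : ℚ),((3 : ℤ) : ℚ)]} (hxo : x ∈ order (-1) 3) (hx : x.re = 0)
    (hQ : (x * star x).re = 1) :
    (∃ w ∈ order (-1) 3, x - ⟨0, 1, 0, 0⟩ = (2 : ℚ) • w) ∨ (∃ w ∈ order (-1) 3, x - ⟨0, 2, 1, 0⟩ = (2 : ℚ) • w) ∨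
      (∃ w ∈ order (-1) 3, x - ⟨0, 2, 0, 1⟩ = (2 : ℚ) • w) := by
  obtain ⟨m, rfl⟩ := hxo
  obtain ⟨h0, hmt⟩ := coords_of_special hx (t := 1) (by rw [hQ]; norm_num)
  have ht : (m 1 ^ 2 - 3 * m 2 ^ 2 - 3 * m 3 ^ 2) % 4 = 1 := by rw [hmt]; norm_num
  have e₁ : (⟨0, 1, 0, 0⟩ : ℍ[ℚ,((-1 : ℤ) : ℚ),((3 : ℤ) : ℚ)]) = ofCoords (-1) 3 (fun k ↦ ((![0, 1, 0, 0] k : ℤ) : ℚ)) := by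
    ext <;> simp [ofCoords]
  have e₂ : (⟨0, 2, 1, 0⟩ : ℍ[ℚ,((-1 : ℤ) : ℚ),((3 : ℤ) : ℚ)]) = ofCoords (-1) 3 (fun k ↦ ((![0, 2, 1, 0] k : ℤ) : ℚ)) := by
    ext <;> simp [ofCoords]
  have e₃ : (⟨0, 2, 0, 1⟩ : ℍ[ℚ,((-1 : ℤ) : ℚ),((3 : ℤ) : ℚ)]) = ofCoords (-1) 3 (fun k ↦ ((![0, 2, 0, 1] k : ℤ) : ℚ)) := by
    ext <;> simp [ofCoords]
  rw [e₁, e₂, e₃, exists_ofCoords_sub_eq_two_smul_iff, exists_ofCoords_sub_eq_two_smul_iff,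
    exists_ofCoords_sub_eq_two_smul_iff]
  rcases parity_of_norm_mod_four_eq_one ht with ⟨h₁, h₂, h₃⟩ | ⟨h₁, h₂, h₃⟩ | ⟨h₁, h₂, h₃⟩
  · refine Or.inl fun k ↦ ?_
    fin_cases k <;> simp <;> omega
  · refine Or.inr (Or.inl fun k ↦ ?_)
    fin_cases k <;> simp <;> omega
  · refine Or.inr (Or.inr fun k ↦ ?_)
    fin_cases k <;> simp <;> omega

/-- … and to exactly one of them: the three classes of `i`, `2i + j`, `2i + ij` are pairwise distinct.
[cite: KudlaRapoportYang2006, §3.4 (3.4.13)] [cite: Lang1982AbelianFunctions, Ch. IX §4] -/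
theorem modTwo_classes_norm_one_pairwise_ne (x : ℍ[ℚ,((-1 : ℤ) : ℚ),((3 : ℤ) : ℚ)]) :
    ¬ ((∃ w ∈ order (-1) 3, x - ⟨0, 1, 0, 0⟩ = (2 : ℚ) • w) ∧ ∃ w ∈ order (-1) 3, x - ⟨0, 2, 1, 0⟩ = (2 : ℚ) • w) ∧
    ¬ ((∃ w ∈ order (-1) 3, x - ⟨0, 1, 0, 0⟩ = (2 : ℚ) • w) ∧ ∃ w ∈ order (-1) 3, x - ⟨0, 2, 0, 1⟩ = (2 : ℚ) • w) ∧
    ¬ ((∃ w ∈ order (-1) 3, x - ⟨0, 2, 1, 0⟩ = (2 : ℚ) • w) ∧ ∃ w ∈ order (-1) 3, x - ⟨0, 2, 0, 1⟩ = (2 : ℚ) • w) :=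
  ⟨not_and_of_odd_coord (m := ![0, 1, 1, 0]) (by rw [QuaternionAlgebra.mk_sub_mk]; ext <;> simp [ofCoords]; norm_num)
      (k := 2) (by decide),
    not_and_of_odd_coord (m := ![0, 1, 0, 1]) (by rw [QuaternionAlgebra.mk_sub_mk]; ext <;> simp [ofCoords]; norm_num)
      (k := 3) (by decide),
    not_and_of_odd_coord (m := ![0, 0, -1, 1]) (by rw [QuaternionAlgebra.mk_sub_mk]; ext <;> simp [ofCoords])
      (k := 3) (by decide)⟩

/-- **Every `x ∈ L(6)` is congruent mod `2𝔬` to `3i + j`, to `3i + ij` or to `6i + j + 3ij`** — the special vectors of the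
three `Z(6)`-points `τ₆`, `i√(2 − √3)`, `τ₆″` of g29-#3 (one abelian surface `(ℂ/ℤ[√−6])²`, three QM structures) represent
ALL classes of `L(6)`. [cite: KudlaRapoportYang2006, §3.4 (3.4.8), (3.4.13)–(3.4.14)] [cite: Lang1982AbelianFunctions, Ch. IX §4–§5 Thm. 5.1] -/
theorem modTwo_classes_norm_six {x : ℍ[ℚ,((-1 : ℤ) : ℚ),((3 : ℤ) : ℚ)]} (hxo : x ∈ order (-1) 3) (hx : x.re = 0)
    (hQ : (x * star x).re = 6) :
    (∃ w ∈ order (-1) 3, x - ⟨0, 3, 1, 0⟩ = (2 : ℚ) • w) ∨ (∃ w ∈ order (-1) 3, x - ⟨0, 3, 0, 1⟩ = (2 : ℚ) • w) ∨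
      (∃ w ∈ order (-1) 3, x - ⟨0, 6, 1, 3⟩ = (2 : ℚ) • w) := by
  obtain ⟨m, rfl⟩ := hxo
  obtain ⟨h0, hmt⟩ := coords_of_special hx (t := 6) (by rw [hQ]; norm_num)
  have ht : (m 1 ^ 2 - 3 * m 2 ^ 2 - 3 * m 3 ^ 2) % 4 = 2 := by rw [hmt]; norm_num
  have e₁ : (⟨0, 3, 1, 0⟩ : ℍ[ℚ,((-1 : ℤ) : ℚ),((3 : ℤ) : ℚ)]) = ofCoords (-1) 3 (fun k ↦ ((![0, 3, 1, 0] k : ℤ) : ℚ)) := by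
    ext <;> simp [ofCoords]
  have e₂ : (⟨0, 3, 0, 1⟩ : ℍ[ℚ,((-1 : ℤ) : ℚ),((3 : ℤ) : ℚ)]) = ofCoords (-1) 3 (fun k ↦ ((![0, 3, 0, 1] k : ℤ) : ℚ)) := by
    ext <;> simp [ofCoords]
  have e₃ : (⟨0, 6, 1, 3⟩ : ℍ[ℚ,((-1 : ℤ) : ℚ),((3 : ℤ) : ℚ)]) = ofCoords (-1) 3 (fun k ↦ ((![0, 6, 1, 3] k : ℤ) : ℚ)) := by
    ext <;> simp [ofCoords]
  rw [e₁, e₂, e₃, exists_ofCoords_sub_eq_two_smul_iff, exists_ofCoords_sub_eq_two_smul_iff,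
    exists_ofCoords_sub_eq_two_smul_iff]
  rcases parity_of_norm_mod_four_eq_two ht with ⟨h₁, h₂, h₃⟩ | ⟨h₁, h₂, h₃⟩ | ⟨h₁, h₂, h₃⟩
  · refine Or.inl fun k ↦ ?_
    fin_cases k <;> simp <;> omega
  · refine Or.inr (Or.inl fun k ↦ ?_)
    fin_cases k <;> simp <;> omega
  · refine Or.inr (Or.inr fun k ↦ ?_)
    fin_cases k <;> simp <;> omega

/-- … and to exactly one of them: the classes of `3i + j`, `3i + ij`, `6i + j + 3ij` are pairwise distinct (g29-#3's three
obstructions, restated as exclusions). [cite: KudlaRapoportYang2006, §3.4 (3.4.13)] [cite: Lang1982AbelianFunctions, Ch. IX §4] -/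
theorem modTwo_classes_norm_six_pairwise_ne (x : ℍ[ℚ,((-1 : ℤ) : ℚ),((3 : ℤ) : ℚ)]) :
    ¬ ((∃ w ∈ order (-1) 3, x - ⟨0, 3, 1, 0⟩ = (2 : ℚ) • w) ∧ ∃ w ∈ order (-1) 3, x - ⟨0, 3, 0, 1⟩ = (2 : ℚ) • w) ∧
    ¬ ((∃ w ∈ order (-1) 3, x - ⟨0, 3, 1, 0⟩ = (2 : ℚ) • w) ∧ ∃ w ∈ order (-1) 3, x - ⟨0, 6, 1, 3⟩ = (2 : ℚ) • w) ∧
    ¬ ((∃ w ∈ order (-1) 3, x - ⟨0, 3, 0, 1⟩ = (2 : ℚ) • w) ∧ ∃ w ∈ order (-1) 3, x - ⟨0, 6, 1, 3⟩ = (2 : ℚ) • w) :=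
  ⟨not_and_of_odd_coord (m := ![0, 0, -1, 1]) (by rw [QuaternionAlgebra.mk_sub_mk]; ext <;> simp [ofCoords])
      (k := 3) (by decide),
    not_and_of_odd_coord (m := ![0, 3, 0, 3]) (by rw [QuaternionAlgebra.mk_sub_mk]; ext <;> simp [ofCoords]; norm_num)
      (k := 1) (by decide),
    not_and_of_odd_coord (m := ![0, 3, 1, 2])
      (by rw [QuaternionAlgebra.mk_sub_mk]; ext <;> simp [ofCoords]; all_goals norm_num) (k := 1) (by decide)⟩

end Attained

end Literature.Geometry.Kaehler.ComplexTorus.QuaternionType
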